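import Summits.KontsevichZagierPeriods.KontsevichZagierPeriods.Theorems.HurwitzMicroSectorsNormalFormPrincipleLevelOne
import Summits.KontsevichZagierPeriods.KontsevichZagierPeriods.Theorems.HurwitzMicroSectorsNormalFormPrincipleSlabASubPtK20
import Summits.KontsevichZagierPeriods.KontsevichZagierPeriods.Theorems.HurwitzMicroSectorsNormalFormPrincipleAlgCarriers
import Summits.KontsevichZagierPeriods.KontsevichZagierPeriods.Theorems.HurwitzMicroSectorsNormalFormPrincipleM2FiveZetaTwo
import Summits.KontsevichZagierPeriods.KontsevichZagierPeriods.Theorems.HurwitzMicroSectorsNormalFormPrincipleAlgMergeAndSwap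
import Summits.KontsevichZagierPeriods.KontsevichZagierPeriods.Theorems.HurwitzMicroSectorsNormalFormPrincipleAlgTriangleSubDimOne
import Summits.KontsevichZagierPeriods.KontsevichZagierPeriods.Theorems.HurwitzMicroSectorsNormalFormPrincipleAlgMonomialsToPoints
import Summits.KontsevichZagierPeriods.KontsevichZagierPeriods.Theorems.HurwitzMicroSectorsNormalFormPrincipleAlgExistsReps
import Summits.KontsevichZagierPeriods.KontsevichZagierPeriods.Theorems.HurwitzMicroSectorsNormalFormPrincipleAlgRigidKit

/-!
# `NormalFormPrinciple` (stmt-KontsevichZagierPeriods-3869), line `SketchIdeator1` — leaf `stub_boxRigidity`: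
# LEVEL ONE WITH REAL-ALGEBRAIC COEFFICIENTS, I: reduction to the normal form

Seat c7's level-one layer `[(0,1)², P/(1 − xy)]`, `P ∈ ℚ[x,y]`, is enlarged to `P ∈ (ℚ̄ ∩ ℝ)[x,y]`
(the route's "ℚ̄-coefficient enlargement" of the box family): every such box reduces, inside
`FormalRep ⧸ relations` and using only the Kontsevich–Zagier rules (1a) additivity, (1b) domain
additivity, (2) algebraic change of variables and (3) Stokes, to the normal form
`[(0,1)², β/(1 − xy)] + [pt, q]` with `β, q` real algebraic (`alg_levelOne_normalForm`).

Pipeline per monomial `c·xᵃyᵇ/(1−xy)` (`alg_monomial_normalForm`): for `b < a` merge `u = xy` to the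
triangle `[0<u<x<1, c·x^(a−b−1)u^b/(1−u)]` (`alg_merge_and_swap`), integrate out to dimension one
(`alg_triangle_sub_dimOne`), and collapse to the algebraic point `c/(a−b)·Σ_{i<a−b} 1/(b+i+1)`
(`alg_monomials_to_points`); `a < b` by the swap; on the diagonal `a = b` write
`c(xy)ᵃ/(1−xy) = c/(1−xy) − Σ_{i<a} c(xy)ⁱ` and collapse each `c(xy)ⁱ` to the point `c/(i+1)²`.
Sums and polynomials by integrand additivity (`alg_sum_normalForm`). Part II
(`…AlgLevelOneLayer`) turns this into the kernel form of Conjecture 1 on this layer, unconditionally,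
via the transcendence of `π`. [cite: KontsevichZagier2001, §1.2]
-/

noncomputable section

open MeasureTheory Set
open Literature.NumberTheory.Transcendental Literature.NumberTheory.Transcendental.KZ
open Literature.ModelTheory.ExponentialFields (IsSemialgebraic)

namespace Summit.KontsevichZagierPeriods.HurwitzMicroSectors.NormalFormPrinciple.PiBox.AlgLevelOne

/-! ## The assembly (lead): reduction to the normal form `[(0,1)², β/(1−xy)] + [pt, q]`, `β, q ∈ ℚ̄ ∩ ℝ` -/

open Summit.KontsevichZagierPeriods.HurwitzMicroSectors.NormalFormPrinciple.PiBox.Dlog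
  (pt_add_mem_relations pt_zero_mem_relations pt_congr_mem_relations exists_ptCarrierA)
open Summit.KontsevichZagierPeriods.HurwitzMicroSectors.NormalFormPrinciple.PiBox.LevelOne (diag_identity)

/-- Real-algebraic numbers are closed under the field operations used below. [folklore] -/
theorem isAlgebraic_ratCast_mul {c : ℝ} (hc : IsAlgebraic ℚ c) (r : ℚ) : IsAlgebraic ℚ ((r : ℝ) * c) := by
  have h1 : IsIntegral ℚ c := isAlgebraic_iff_isIntegral.1 hc
  have h2 : IsIntegral ℚ (r : ℝ) := isIntegral_algebraMap (R := ℚ) (A := ℝ) (x := r)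
  exact isAlgebraic_iff_isIntegral.2 (h2.mul h1)

/-- Sums of real-algebraic numbers are real-algebraic. [folklore] -/
theorem isAlgebraic_add' {c d : ℝ} (hc : IsAlgebraic ℚ c) (hd : IsAlgebraic ℚ d) : IsAlgebraic ℚ (c + d) :=
  isAlgebraic_iff_isIntegral.2 ((isAlgebraic_iff_isIntegral.1 hc).add (isAlgebraic_iff_isIntegral.1 hd))

/-- Negatives of real-algebraic numbers are real-algebraic. [folklore] -/
theorem isAlgebraic_neg' {c : ℝ} (hc : IsAlgebraic ℚ c) : IsAlgebraic ℚ (-c) :=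
  isAlgebraic_iff_isIntegral.2 (isAlgebraic_iff_isIntegral.1 hc).neg

/-- A zero ζ-box is a relation. [cite: KontsevichZagier2001, §1.2 rule (1)] -/
theorem zetaBoxA_zero_mem_relations (B : IntegralRep 2)
    (hBi : EqOn B.integrand (fun x => (0:ℝ) / (1 - x 0 * x 1)) B.domain) : of B ∈ relations :=
  of_mem_relations_of_eqOn_zero B fun x hx => by rw [hBi hx]; simp

/-- **Normal form of ONE monomial `[(0,1)², c x^a y^b/(1 − xy)]` with an algebraic coefficient**:
off the diagonal it is an algebraic POINT (merge gadget → triangle → dimension one → point); on the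
diagonal it is `[(0,1)², c/(1−xy)] + [pt, −c Σ_{i<a} 1/(i+1)²]`. [cite: KontsevichZagier2001, §1.2] -/
theorem alg_monomial_normalForm (c : ℝ) (hc : IsAlgebraic ℚ c) (a b : ℕ) (N : IntegralRep 2)
    (hNd : N.domain = {x | ∀ i, x i ∈ Set.Ioo (0:ℝ) 1})
    (hNi : EqOn N.integrand (fun x => c * (x 0 ^ a * x 1 ^ b) / (1 - x 0 * x 1)) N.domain) :
    ∃ β q : ℝ, IsAlgebraic ℚ β ∧ IsAlgebraic ℚ q ∧ ∀ (B : IntegralRep 2) (Z : IntegralRep 0),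
      B.domain = {x | ∀ i, x i ∈ Set.Ioo (0:ℝ) 1} →
      EqOn B.integrand (fun x => β / (1 - x 0 * x 1)) B.domain →
      Z.domain = Set.univ → (Z.integrand = fun _ => q) → of N - of B - of Z ∈ relations := by
  obtain ⟨hexN, hexR, hexN₁, hexM, hexZ⟩ := alg_exists_reps c hc
  obtain ⟨hpoly, hdiag⟩ := alg_monomials_to_points c hc
  obtain ⟨-, -, -, -, hptadd, -⟩ := alg_rigid_kit
  obtain ⟨Zf, hZf⟩ := exists_ptCarrierA
  -- off-diagonal case, `b < a`
  have offdiag : ∀ (a b : ℕ), b < a → ∀ (N : IntegralRep 2),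
      N.domain = {x | ∀ i, x i ∈ Set.Ioo (0:ℝ) 1} →
      EqOn N.integrand (fun x => c * (x 0 ^ a * x 1 ^ b) / (1 - x 0 * x 1)) N.domain →
      ∃ β q : ℝ, IsAlgebraic ℚ β ∧ IsAlgebraic ℚ q ∧ ∀ (B : IntegralRep 2) (Z : IntegralRep 0),
        B.domain = {x | ∀ i, x i ∈ Set.Ioo (0:ℝ) 1} →
        EqOn B.integrand (fun x => β / (1 - x 0 * x 1)) B.domain →
        Z.domain = Set.univ → (Z.integrand = fun _ => q) → of N - of B - of Z ∈ relations := by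
    intro a b hab N hNd hNi
    obtain ⟨R, hRd, hRi⟩ := hexR a b hab
    obtain ⟨N₁, hN₁d, hN₁i⟩ := hexN₁ b (a - b)
    refine ⟨0, c / ((a - b : ℕ) : ℝ) * ∑ i ∈ Finset.range (a - b), (1:ℝ) / ((b + i + 1 : ℕ) : ℝ),
      isAlgebraic_zero, ?_, fun B Z hBd hBi hZd hZi => ?_⟩
    · have hr : c / ((a - b : ℕ) : ℝ) * ∑ i ∈ Finset.range (a - b), (1:ℝ) / ((b + i + 1 : ℕ) : ℝ) =
          (((1 / (a - b : ℕ) * ∑ i ∈ Finset.range (a - b), (1:ℚ) / ((b + i + 1 : ℕ) : ℚ)) : ℚ) : ℝ) * c := by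
        push_cast
        ring
      rw [hr]
      exact isAlgebraic_ratCast_mul hc _
    · have e1 := (alg_merge_and_swap a b c hc).1 hab N R hNd hNi hRd (hRi ▸ fun _ _ => rfl)
      have e2 := alg_triangle_sub_dimOne a b c hc hab R N₁ hRd (hRi ▸ fun _ _ => rfl) hN₁d
        (hN₁i ▸ fun _ _ => rfl)
      have e3 := hpoly b (a - b) (Nat.sub_pos_of_lt hab) N₁ Z hN₁d (hN₁i ▸ fun _ _ => rfl) hZd hZi
      have eB := zetaBoxA_zero_mem_relations B hBi
      have e : of N - of B - of Z = (of N - of R) + (of R - of N₁) + (of N₁ - of Z) - of B := by abel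
      rw [e]
      exact relations.sub_mem (relations.add_mem (relations.add_mem e1 e2) e3) eB
  rcases lt_trichotomy b a with hab | rfl | hab
  · exact offdiag a b hab N hNd hNi
  · -- diagonal: `c t^a/(1−t) = c/(1−t) − c Σ_{i<a} t^i`
    obtain ⟨Bc, hBcd, hBci⟩ := hexN 0 0
    have hM : ∀ i : ℕ, ∃ M : IntegralRep 2, M.domain = {x | ∀ i, x i ∈ Set.Ioo (0:ℝ) 1} ∧
        M.integrand = fun x => c * (x 0 * x 1) ^ i := hexM
    choose M hMd hMi using hM
    -- `[c/(1−t)] ≡ N + Σ_i M_i`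
    have esum : of Bc - of N - ∑ i : Fin b, of (M i) ∈ relations := by
      refine of_sub_of_sub_sum_mem_relations b Bc N (fun i => M i) (hNd.trans hBcd.symm)
        (fun i => (hMd i).trans hBcd.symm) fun x hx => ?_
      rw [hBcd] at hx
      have ht : 1 - x 0 * x 1 ≠ 0 := (LevelOne.one_sub_mul_pos_of_mem_box hx).ne'
      show Bc.integrand x = N.integrand x + ∑ i : Fin b, (M i).integrand x
      rw [hBci, hNi (hNd ▸ hx), Fin.sum_univ_eq_sum_range (fun i => (M i).integrand x) b]
      simp only [hMi, pow_zero, mul_one]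
      have h := diag_identity c (x 0 * x 1) b ht
      rw [mul_pow, Finset.mul_sum] at h
      linarith
    -- each `M_i` is a point
    have ept : ∀ i : ℕ, of (M i) - of (Zf (c / (((i + 1) ^ 2 : ℕ) : ℝ))) ∈ relations := by
      intro i
      have halg : IsAlgebraic ℚ (c / (((i + 1) ^ 2 : ℕ) : ℝ)) := by
        have : c / (((i + 1) ^ 2 : ℕ) : ℝ) = (((1 / ((i + 1) ^ 2 : ℕ) : ℚ)) : ℝ) * c := by
          push_cast; ring
        rw [this]; exact isAlgebraic_ratCast_mul hc _
      exact hdiag i (M i) _ (hMd i) ((hMi i) ▸ fun _ _ => rfl) (hZf _ halg).1 (hZf _ halg).2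
    -- the sum of the points is one point
    have hq : ∀ n : ℕ, IsAlgebraic ℚ (∑ i ∈ Finset.range n, c / (((i + 1) ^ 2 : ℕ) : ℝ)) := by
      intro n
      have : (∑ i ∈ Finset.range n, c / (((i + 1) ^ 2 : ℕ) : ℝ)) =
          ((∑ i ∈ Finset.range n, (1 : ℚ) / ((i + 1) ^ 2 : ℕ) : ℚ) : ℝ) * c := by
        push_cast
        rw [Finset.sum_mul]
        refine Finset.sum_congr rfl fun i _ => ?_
        ring
      rw [this]; exact isAlgebraic_ratCast_mul hc _
    have esumpt : ∀ n : ℕ, of (Zf (∑ i ∈ Finset.range n, c / (((i + 1) ^ 2 : ℕ) : ℝ))) -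
        ∑ i ∈ Finset.range n, of (Zf (c / (((i + 1) ^ 2 : ℕ) : ℝ))) ∈ relations := by
      intro n
      induction n with
      | zero =>
        simp only [Finset.range_zero, Finset.sum_empty, sub_zero]
        exact pt_zero_mem_relations _ (hZf 0 isAlgebraic_zero).2
      | succ n ih =>
        have halg1 : IsAlgebraic ℚ (c / (((n + 1) ^ 2 : ℕ) : ℝ)) := by
          have : c / (((n + 1) ^ 2 : ℕ) : ℝ) = (((1 / ((n + 1) ^ 2 : ℕ) : ℚ)) : ℝ) * c := by
            push_cast; ring
          rw [this]; exact isAlgebraic_ratCast_mul hc _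
        have eadd := hptadd _ _ (Zf (∑ i ∈ Finset.range (n + 1), c / (((i + 1) ^ 2 : ℕ) : ℝ)))
          (Zf (∑ i ∈ Finset.range n, c / (((i + 1) ^ 2 : ℕ) : ℝ))) (Zf (c / (((n + 1) ^ 2 : ℕ) : ℝ)))
          (hZf _ (hq (n + 1))).1 (by rw [(hZf _ (hq (n + 1))).2, Finset.sum_range_succ])
          (hZf _ (hq n)).1 (hZf _ (hq n)).2 (hZf _ halg1).1 (hZf _ halg1).2
        have hs : ∑ i ∈ Finset.range (n + 1), of (Zf (c / (((i + 1) ^ 2 : ℕ) : ℝ))) =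
            ∑ i ∈ Finset.range n, of (Zf (c / (((i + 1) ^ 2 : ℕ) : ℝ))) +
              of (Zf (c / (((n + 1) ^ 2 : ℕ) : ℝ))) := Finset.sum_range_succ _ _
        rw [hs]
        have e : of (Zf (∑ i ∈ Finset.range (n + 1), c / (((i + 1) ^ 2 : ℕ) : ℝ))) -
            (∑ i ∈ Finset.range n, of (Zf (c / (((i + 1) ^ 2 : ℕ) : ℝ))) +
              of (Zf (c / (((n + 1) ^ 2 : ℕ) : ℝ)))) =
            (of (Zf (∑ i ∈ Finset.range (n + 1), c / (((i + 1) ^ 2 : ℕ) : ℝ))) -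
              of (Zf (∑ i ∈ Finset.range n, c / (((i + 1) ^ 2 : ℕ) : ℝ))) -
              of (Zf (c / (((n + 1) ^ 2 : ℕ) : ℝ)))) +
            (of (Zf (∑ i ∈ Finset.range n, c / (((i + 1) ^ 2 : ℕ) : ℝ))) -
              ∑ i ∈ Finset.range n, of (Zf (c / (((i + 1) ^ 2 : ℕ) : ℝ)))) := by abel
        rw [e]
        exact relations.add_mem eadd ih
    refine ⟨c, -(∑ i ∈ Finset.range b, c / (((i + 1) ^ 2 : ℕ) : ℝ)), hc, isAlgebraic_neg' (hq b),
      fun B Z hBd hBi hZd hZi => ?_⟩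
    -- `B ≡ Bc`, `Z + Zq ≡ 0`
    have eB : of Bc - of B ∈ relations :=
      of_sub_of_mem_relations_of_eqOn (hBd.trans hBcd.symm) fun x hx => by
        rw [hBci, hBi (by rw [hBd, ← hBcd]; exact hx)]
        simp
    have eZ : of (Zf 0) - of Z - of (Zf (∑ i ∈ Finset.range b, c / (((i + 1) ^ 2 : ℕ) : ℝ))) ∈
        relations :=
      hptadd _ _ (Zf 0) Z (Zf _) (hZf 0 isAlgebraic_zero).1
        (by rw [(hZf 0 isAlgebraic_zero).2]; funext; simp) hZd hZi (hZf _ (hq b)).1 (hZf _ (hq b)).2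
    have eZ0 : of (Zf 0) ∈ relations := pt_zero_mem_relations _ (hZf 0 isAlgebraic_zero).2
    have eM : ∑ i : Fin b, of (M i) - ∑ i ∈ Finset.range b, of (Zf (c / (((i + 1) ^ 2 : ℕ) : ℝ))) ∈
        relations := by
      rw [Fin.sum_univ_eq_sum_range (fun i => of (M i)) b, ← Finset.sum_sub_distrib]
      exact AddSubgroup.sum_mem _ fun i _ => ept i
    have e : of N - of B - of Z = -(of Bc - of N - ∑ i : Fin b, of (M i)) + (of Bc - of B)
        - (∑ i : Fin b, of (M i) - ∑ i ∈ Finset.range b, of (Zf (c / (((i + 1) ^ 2 : ℕ) : ℝ))))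
        + (of (Zf (∑ i ∈ Finset.range b, c / (((i + 1) ^ 2 : ℕ) : ℝ))) -
            ∑ i ∈ Finset.range b, of (Zf (c / (((i + 1) ^ 2 : ℕ) : ℝ))))
        + (of (Zf 0) - of Z - of (Zf (∑ i ∈ Finset.range b, c / (((i + 1) ^ 2 : ℕ) : ℝ)))) - of (Zf 0) := by
      abel
    rw [e]
    exact relations.sub_mem (relations.add_mem (relations.add_mem (relations.sub_mem (relations.add_mem
      (relations.neg_mem esum) eB) eM) (esumpt b)) eZ) eZ0
  · -- `a < b`: swap first
    obtain ⟨N', hN'd, hN'i⟩ := hexN b a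
    have e0 := (alg_merge_and_swap a b c hc).2 N N' hNd hNi hN'd (hN'i ▸ fun _ _ => rfl)
    obtain ⟨β, q, hβ, hq, h⟩ := offdiag b a hab N' hN'd (hN'i ▸ fun _ _ => rfl)
    refine ⟨β, q, hβ, hq, fun B Z hBd hBi hZd hZi => ?_⟩
    have e : of N - of B - of Z = (of N - of N') + (of N' - of B - of Z) := by abel
    rw [e]
    exact relations.add_mem e0 (h B Z hBd hBi hZd hZi)

/-! ## Sums of monomials: existence and reduction -/

/-- **Existence of the algebraic level-one representation** `[(0,1)², (Σ_{s∈S} c_s x^{s₀}y^{s₁})/(1−xy)]`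
for real-algebraic coefficients `c_s`. [cite: KontsevichZagier2001, §1.1] -/
theorem exists_algLevelOneRep (S : Finset (Fin 2 →₀ ℕ)) (coef : (Fin 2 →₀ ℕ) → ℝ)
    (halg : ∀ s ∈ S, IsAlgebraic ℚ (coef s)) :
    ∃ N : IntegralRep 2, N.domain = {x | ∀ i, x i ∈ Set.Ioo (0:ℝ) 1} ∧
      N.integrand = fun x => (∑ s ∈ S, coef s * (x 0 ^ (s 0) * x 1 ^ (s 1))) / (1 - x 0 * x 1) := by
  classical
  induction S using Finset.induction_on with
  | empty =>
    obtain ⟨N, hNd, hNi⟩ := (alg_exists_reps 0 isAlgebraic_zero).1 0 0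
    refine ⟨N, hNd, ?_⟩
    rw [hNi]
    funext x
    simp
  | insert s S hs ih =>
    obtain ⟨N₁, hN₁d, hN₁i⟩ := ih fun t ht => halg t (Finset.mem_insert_of_mem ht)
    obtain ⟨N₂, hN₂d, hN₂i⟩ := (alg_exists_reps (coef s) (halg s (Finset.mem_insert_self s S))).1 (s 0) (s 1)
    refine ⟨⟨N₁.domain, fun x => (∑ t ∈ insert s S, coef t * (x 0 ^ (t 0) * x 1 ^ (t 1))) / (1 - x 0 * x 1),
      N₁.isSemialgebraic_domain, ?_, ?_⟩, hN₁d, rfl⟩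
    · refine (IsSemialgebraicFunOn.add_holds (hN₂d.trans hN₁d.symm ▸ N₂.isSemialgebraicFunOn_integrand)
        N₁.isSemialgebraicFunOn_integrand).congr fun x _ => ?_
      rw [hN₁i, hN₂i]
      simp only [Pi.add_apply, Finset.sum_insert hs]
      ring
    · have h := ((hN₂d.trans hN₁d.symm) ▸ N₂.integrableOn).add N₁.integrableOn
      refine h.congr_fun (fun x _ => ?_) (IntegralRep.measurableSet_domain_holds N₁)
      rw [hN₁i, hN₂i]
      simp only [Pi.add_apply, Finset.sum_insert hs]
      ring

/-- **Reduction of a finite sum of algebraic level-one monomials to the normal form**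
`[(0,1)², β/(1−xy)] + [pt, q]`, `β, q` real-algebraic (monomial by monomial, `alg_monomial_normalForm`,
glued by integrand additivity). [cite: KontsevichZagier2001, §1.2] -/
theorem alg_sum_normalForm (coef : (Fin 2 →₀ ℕ) → ℝ) : ∀ (S : Finset (Fin 2 →₀ ℕ)),
    (∀ s ∈ S, IsAlgebraic ℚ (coef s)) → ∀ (N : IntegralRep 2),
    N.domain = {x | ∀ i, x i ∈ Set.Ioo (0:ℝ) 1} →
    EqOn N.integrand (fun x => (∑ s ∈ S, coef s * (x 0 ^ (s 0) * x 1 ^ (s 1))) / (1 - x 0 * x 1)) N.domain →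
    ∃ β q : ℝ, IsAlgebraic ℚ β ∧ IsAlgebraic ℚ q ∧ ∀ (B : IntegralRep 2) (Z : IntegralRep 0),
      B.domain = {x | ∀ i, x i ∈ Set.Ioo (0:ℝ) 1} →
      EqOn B.integrand (fun x => β / (1 - x 0 * x 1)) B.domain →
      Z.domain = Set.univ → (Z.integrand = fun _ => q) → of N - of B - of Z ∈ relations := by
  classical
  obtain ⟨-, -, -, hBadd, hptadd, hexB⟩ := alg_rigid_kit
  obtain ⟨Zf, hZf⟩ := exists_ptCarrierA
  intro S
  induction S using Finset.induction_on with
  | empty =>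
    intro _ N hNd hNi
    refine ⟨0, 0, isAlgebraic_zero, isAlgebraic_zero, fun B Z hBd hBi hZd hZi => ?_⟩
    have hN : of N ∈ relations := of_mem_relations_of_eqOn_zero N fun x hx => by rw [hNi hx]; simp
    have hB := zetaBoxA_zero_mem_relations B hBi
    have hZ := pt_zero_mem_relations Z hZi
    exact relations.sub_mem (relations.sub_mem hN hB) hZ
  | insert s S hs ih =>
    intro halg N hNd hNi
    have halgS : ∀ t ∈ S, IsAlgebraic ℚ (coef t) := fun t ht => halg t (Finset.mem_insert_of_mem ht)
    have halgs : IsAlgebraic ℚ (coef s) := halg s (Finset.mem_insert_self s S)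
    obtain ⟨N₁, hN₁d, hN₁i⟩ := exists_algLevelOneRep S coef halgS
    obtain ⟨N₂, hN₂d, hN₂i⟩ := (alg_exists_reps (coef s) halgs).1 (s 0) (s 1)
    obtain ⟨β₁, q₁, hβ₁, hq₁, h₁⟩ := ih halgS N₁ hN₁d (hN₁i ▸ fun _ _ => rfl)
    obtain ⟨β₂, q₂, hβ₂, hq₂, h₂⟩ := alg_monomial_normalForm (coef s) halgs (s 0) (s 1) N₂ hN₂d
      (hN₂i ▸ fun _ _ => rfl)
    refine ⟨β₁ + β₂, q₁ + q₂, isAlgebraic_add' hβ₁ hβ₂, isAlgebraic_add' hq₁ hq₂,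
      fun B Z hBd hBi hZd hZi => ?_⟩
    obtain ⟨B₁, hB₁d, hB₁i⟩ := hexB β₁ hβ₁
    obtain ⟨B₂, hB₂d, hB₂i⟩ := hexB β₂ hβ₂
    have eN : of N - of N₂ - of N₁ ∈ relations := by
      refine integrandAddRel_subset_relations ⟨2, N, N₂, N₁, hN₂d.trans hNd.symm, hN₁d.trans hNd.symm,
        fun x hx => ?_, rfl⟩
      rw [Pi.add_apply, hNi hx, hN₁i, hN₂i]
      simp only [Finset.sum_insert hs]
      ring
    have e₁ := h₁ B₁ (Zf q₁) hB₁d (hB₁i ▸ fun _ _ => rfl) (hZf q₁ hq₁).1 (hZf q₁ hq₁).2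
    have e₂ := h₂ B₂ (Zf q₂) hB₂d (hB₂i ▸ fun _ _ => rfl) (hZf q₂ hq₂).1 (hZf q₂ hq₂).2
    have eB := hBadd β₁ β₂ B B₁ B₂ hBd hBi hB₁d (hB₁i ▸ fun _ _ => rfl) hB₂d (hB₂i ▸ fun _ _ => rfl)
    have eZ := hptadd q₁ q₂ Z (Zf q₁) (Zf q₂) hZd hZi (hZf q₁ hq₁).1 (hZf q₁ hq₁).2 (hZf q₂ hq₂).1
      (hZf q₂ hq₂).2
    have e : of N - of B - of Z = (of N - of N₂ - of N₁) + (of N₁ - of B₁ - of (Zf q₁))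
        + (of N₂ - of B₂ - of (Zf q₂)) - (of B - of B₁ - of B₂) - (of Z - of (Zf q₁) - of (Zf q₂)) := by
      abel
    rw [e]
    exact relations.sub_mem (relations.sub_mem (relations.add_mem (relations.add_mem eN e₁) e₂) eB) eZ

/-- Evaluating a real polynomial in two variables as a sum over its support. [folklore] -/
theorem mvPolynomial_eval_eq_sum_two (P : MvPolynomial (Fin 2) ℝ) (x : Fin 2 → ℝ) :
    MvPolynomial.eval x P = ∑ s ∈ P.support, P.coeff s * (x 0 ^ (s 0) * x 1 ^ (s 1)) := by
  rw [MvPolynomial.eval_eq]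
  refine Finset.sum_congr rfl fun s _ => ?_
  congr 1
  change s.prod (fun i n => x i ^ n) = _
  rw [Finsupp.prod_fintype _ _ (fun i => pow_zero _), Fin.prod_univ_two]

/-- **Reduction of `[(0,1)², P/(1−xy)]`, `P ∈ (ℚ̄ ∩ ℝ)[x,y]`, to the normal form.**
[cite: KontsevichZagier2001, §1.2] -/
theorem alg_levelOne_normalForm (P : MvPolynomial (Fin 2) ℝ) (hP : ∀ s, IsAlgebraic ℚ (P.coeff s))
    (N : IntegralRep 2) (hNd : N.domain = {x | ∀ i, x i ∈ Set.Ioo (0:ℝ) 1})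
    (hNi : EqOn N.integrand (fun x => MvPolynomial.eval x P / (1 - x 0 * x 1)) N.domain) :
    ∃ β q : ℝ, IsAlgebraic ℚ β ∧ IsAlgebraic ℚ q ∧ ∀ (B : IntegralRep 2) (Z : IntegralRep 0),
      B.domain = {x | ∀ i, x i ∈ Set.Ioo (0:ℝ) 1} →
      EqOn B.integrand (fun x => β / (1 - x 0 * x 1)) B.domain →
      Z.domain = Set.univ → (Z.integrand = fun _ => q) → of N - of B - of Z ∈ relations :=
  alg_sum_normalForm P.coeff P.support (fun s _ => hP s) N hNd fun x hx => by
    rw [hNi hx]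
    beta_reduce
    rw [mvPolynomial_eval_eq_sum_two]

end Summit.KontsevichZagierPeriods.HurwitzMicroSectors.NormalFormPrinciple.PiBox.AlgLevelOne
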